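import Summits.BirchSwinnertonDyer.BirchSwinnertonDyer.Theorems.EisensteinPrimesMazurMCOnCellBKummerCharacterSupply
import Summits.BirchSwinnertonDyer.BirchSwinnertonDyer.Theorems.EisensteinPrimesMazurMCOnCellBKummerCharacterCountStackedRat
import HarnessLib

/-!
# The ONE-KUMMER-PRIME certificate: `λ(X(E/ℚ_∞)) ≥ #S` at the étale end from one Kummer prime `ℓ` of `E`
# and residue checks `q^{(ℓ−1)/p} ≡ 1 (mod ℓ)`
# (route `EisensteinPrimes`, crux 3 `MazurMCOnCellB` = stmt-BirchSwinnertonDyer-19033, line `mudescent`,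
# stub 4″ `stub_lambdaCountWeak_offLocus`, ALGEBRAIC half; width seat bsd-line-x2-p1-w3, D-0154 row 5)

HONEST FRAMING (cell `bsd-eis`; nothing here proves BSD or a main conjecture; 0 cells move): THEOREMS
ONLY — no definition, no named fact, nothing asserted about any particular curve, closes nothing. The
stacked socket (p633408) with the certificate `V = ⟨χ_ℓ⟩ ≅ ℤ/p` supplied by `…KummerCharacterSupply`:
`X2.algebraicLambdaGE_of_kummerPrime` — `W/ℚ` globally minimal, `p` odd multiplicative with `p ∣ #E(ℚ)_tors`,
`S` Tamagawa places (`v ∤ p`, `p ∣ c_v`), a place `v_ℓ ∉ S ∪ {v_p}` at which `E` is split multiplicative with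
`v_ℓ(j)` not a `p`-th power (a Kummer place), a hom `π₀ : (ℤ/ℓ)ˣ →* ℤ/p`, `π₀ ≠ 1`, killing `N v (mod ℓ)` for
`v ∈ S ∪ {v_p}` and for every bad `v ∉ S ∪ {v_p, v_ℓ}` that is not itself a Kummer place. Then with
`μ_an ≤ m`: **`AlgebraicLambdaGE W p (b − m)` for `p^{b + 2·v_p(#E(ℚ)_tors)} ≤ p^{#S+1}·p`** (named facts
`hPT`, `h415`, `hWu`, `hpar` as in lam-b's socket). At the étale end (`m = 0`, `v_p(#E(ℚ)_tors) = 1`):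
`λ ≥ #S`, one more than the Tamagawa budget `#S − 1`. With `exists_unitsHom_of_dvd` every residue hypothesis
is `q^{(ℓ−1)/p} ≡ 1 (mod ℓ)`, `q = N v` — census integer data.

References: [GreenbergLNM1716] §5 proof of Prop. 5.10, pp. 114–118, p. 137; [Wuthrich2014] Thm. 16;
[SerreAbelianLadic1968] I §1.2.
-/

set_option autoImplicit false
-- `Summit.BirchSwinnertonDyer.BirchSwinnertonDyer.…`: the summit and its single sub-problem share a name (D-0017 layout).
set_option linter.dupNamespace false

noncomputable section

open scoped Classical

open Function Field NumberField IsDedekindDomain WeierstrassCurve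
  Literature.NumberTheory.EllipticCurves Literature.NumberTheory.GaloisRepresentations
  Literature.NumberTheory.GaloisCohomology
  Literature.NumberTheory.EllipticCurves.Rank1Residual Literature.NumberTheory.EllipticCurves.ModularForms
  Summit.BirchSwinnertonDyer.Rank1Residual
  Summit.BirchSwinnertonDyer.Rank1Residual.X1.GeneratorCountSqueeze
  Summit.BirchSwinnertonDyer.Rank1Residual.X1.TamagawaSqueeze
  Summit.BirchSwinnertonDyer.BirchSwinnertonDyer.Theorems.EisensteinPrimesMazurMCOnCellBKummerCharacterCountStackedRat
  Summit.BirchSwinnertonDyer.BirchSwinnertonDyer.Theorems.EisensteinPrimesMazurMCOnCellBKummerCharacterSupply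

namespace Summit.BirchSwinnertonDyer.BirchSwinnertonDyer.Theorems.EisensteinPrimesMazurMCOnCellBKummerPrimeCertificate

variable {ℓ : ℕ} [hℓ : Fact ℓ.Prime] {p : ℕ} [hp : Fact p.Prime]
  (π₀ : (ZMod ℓ)ˣ →* Multiplicative (ZMod p))

/-- **The ONE-KUMMER-PRIME CERTIFICATE.** `W/ℚ` globally minimal, `p` odd of multiplicative reduction
with `p ∣ #E(ℚ)_tors`; `S` a finite set of places `v ∤ p` with `p ∣ c_v(E)` (Tamagawa rows); a prime `ℓ`
with its place `v_ℓ ∉ S`, `v_ℓ ∤ p`, at which `E` is SPLIT multiplicative with `v_ℓ(j(E))` not a `p`-th power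
(a Kummer place: `p ∤ ord_ℓ Δ_min`); a hom `π₀ : (ℤ/ℓ)ˣ →* ℤ/p`, `π₀ ≠ 1` (from `exists_unitsHom_of_dvd`
when `p ∣ ℓ − 1`), killing `N v (mod ℓ)` for `v ∈ S` and for `v ∣ p` (`hres`: so `χ_ℓ` is trivial on those
decomposition groups) and, for every BAD place `v ∉ S ∪ {v_p, v_ℓ}`, either killing `N v (mod ℓ)` or `v`
being itself a Kummer place (`hbad`). Then, with the certificate `μ_an ≤ m` (`X2.AnalyticMuLE W p m`) and the
named facts `hPT`, `h415`, `hWu`, `hpar` of lam-b's socket: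
**`AlgebraicLambdaGE W p (b − m)` whenever `p^{b + 2·v_p(#E(ℚ)_tors)} ≤ p^{#S+1} · p`** — the stacked socket
p633408 with `V = ⟨χ_ℓ⟩ ≅ ℤ/p`. At the étale end of a type-A class (`m = 0`, `v_p(#E(ℚ)_tors) = 1`):
`λ(X(E/ℚ_∞)) ≥ #S`, one more than the Tamagawa budget `#S − 1` alone. With `exists_unitsHom_of_dvd` every
residue hypothesis reads `q^{(ℓ−1)/p} ≡ 1 (mod ℓ)`, `q = N v`.
[cite: GreenbergLNM1716, §5 proof of Prop. 5.10, pp. 114–118, p. 137] [cite: Wuthrich2014, Thm. 16 (p. 397)] -/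
theorem X2.algebraicLambdaGE_of_kummerPrime {W : WeierstrassCurve ℚ} [W.IsElliptic] [W.IsGloballyMinimal]
    (hodd : p ≠ 2) (hPT : poitouTate_selmerStructure_duality ℚ)
    (h415 : Greenberg1999.prop415ii_noFiniteSubmodule_of_ordinary_or_multiplicative)
    (hWu : Wuthrich2014.thm16_charIdeal_dvd_multiplicative_of_reducible)
    (hpar : nonempty_modularParametrizationData)
    (hmult : W.HasMultiplicativeReductionAtPrime p) (htors : p ∣ W.torsionOrder)
    (S : Finset (HeightOneSpectrum (𝓞 ℚ))) (hSp : ∀ v ∈ S, ((p : ℕ) : 𝓞 ℚ) ∉ v.asIdeal)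
    (hcv : ∀ v ∈ S,
      p ∣ (W.baseChange (v.adicCompletion ℚ)).localTamagawaNumber (v.adicCompletionIntegers ℚ))
    (hπ₀ : ∃ u : (ZMod ℓ)ˣ, π₀ u ≠ 1)
    (vℓ : HeightOneSpectrum (𝓞 ℚ)) (hvℓ : ((ℓ : ℕ) : 𝓞 ℚ) ∈ vℓ.asIdeal) (hℓS : vℓ ∉ S)
    (hℓp : ((p : ℕ) : 𝓞 ℚ) ∉ vℓ.asIdeal)
    (hKum : W.HasSplitMultiplicativeReductionAt vℓ ∧ ∀ x : vℓ.adicCompletion ℚ,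
      Valued.v (algebraMap ℚ (vℓ.adicCompletion ℚ) W.j) ≠ Valued.v x ^ p)
    (hres : ∀ v : HeightOneSpectrum (𝓞 ℚ), (v ∈ S ∨ ((p : ℕ) : 𝓞 ℚ) ∈ v.asIdeal) →
      ∀ u : (ZMod ℓ)ˣ, (u : ZMod ℓ) = (v.residueCard : ZMod ℓ) → π₀ u = 1)
    (hbad : ∀ v : HeightOneSpectrum (𝓞 ℚ), v ∉ S → ((p : ℕ) : 𝓞 ℚ) ∉ v.asIdeal →
      ((ℓ : ℕ) : 𝓞 ℚ) ∉ v.asIdeal → ¬ W.HasGoodReductionAt v →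
      (∀ u : (ZMod ℓ)ˣ, (u : ZMod ℓ) = (v.residueCard : ZMod ℓ) → π₀ u = 1) ∨
      (W.HasSplitMultiplicativeReductionAt v ∧ ∀ x : v.adicCompletion ℚ,
        Valued.v (algebraMap ℚ (v.adicCompletion ℚ) W.j) ≠ Valued.v x ^ p))
    {m : ℕ} (hμ : X2.AnalyticMuLE W p m)
    {b : ℕ} (hb : p ^ (b + 2 * (W.torsionOrder).factorization p) ≤ p ^ (S.card + 1) * p) :
    AlgebraicLambdaGE W p (b - m) := by
  haveI : NeZero p := ⟨hp.out.ne_zero⟩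
  -- the Kummer character of `ℓ`
  obtain ⟨red, χ, hred, hχ⟩ := exists_character_of_cyclotomicCharacter ℚ ℓ π₀
  obtain ⟨σ₁, hσ₁⟩ := exists_apply_ne_one π₀ red hred χ hχ hπ₀
  have hχp : χ ^ p = 1 := by
    ext σ
    rw [ContinuousMonoidHom.coe_one, Pi.one_apply]
    simp only [ContinuousMonoidHom.pow_apply]
    rw [← ofAdd_toAdd (χ σ), ← ofAdd_nsmul, nsmul_eq_mul, ZMod.natCast_self, zero_mul, ofAdd_zero]
  have hχ1 : χ ≠ 1 := fun h ↦ hσ₁ (by rw [h, ContinuousMonoidHom.coe_one, Pi.one_apply])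
  have hord : orderOf χ = p := orderOf_eq_prime hχp hχ1
  -- `V = ⟨χ⟩ ≅ ℤ/p`
  have hpow_val : ∀ a c : ZMod p, χ ^ (a + c).val = χ ^ a.val * χ ^ c.val := fun a c ↦ by
    rw [ZMod.val_add, ← pow_eq_pow_mod _ hχp, pow_add]
  let f : Multiplicative (ZMod p) →* (absoluteGaloisGroup ℚ →ₜ* Multiplicative (ZMod p)) :=
    { toFun := fun c ↦ χ ^ (Multiplicative.toAdd c).val
      map_one' := by rw [toAdd_one, ZMod.val_zero, pow_zero]
      map_mul' := fun a c ↦ by rw [toAdd_mul, hpow_val] }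
  have hf : ∀ c, f c = χ ^ (Multiplicative.toAdd c).val := fun c ↦ rfl
  have hfinj : Function.Injective f := fun a c h ↦ by
    have ha : (Multiplicative.toAdd a).val < orderOf χ := by rw [hord]; exact ZMod.val_lt _
    have hc : (Multiplicative.toAdd c).val < orderOf χ := by rw [hord]; exact ZMod.val_lt _
    have h' : (Multiplicative.toAdd a).val = (Multiplicative.toAdd c).val :=
      pow_injOn_Iio_orderOf ha hc (by simpa [hf] using h)
    exact congrArg Multiplicative.ofAdd (ZMod.val_injective p h') |>.trans (by simp)
  let V : Subgroup (absoluteGaloisGroup ℚ →ₜ* Multiplicative (ZMod p)) := f.range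
  haveI : Finite V := Finite.of_surjective _ (MonoidHom.rangeRestrict_surjective f)
  have hVcard : Nat.card V = p := by
    rw [← Nat.card_congr (MonoidHom.ofInjective hfinj).toEquiv, Nat.card_congr Multiplicative.toAdd,
      Nat.card_zmod]
  have hVmem : ∀ ψ ∈ V, ∃ n : ℕ, ψ = χ ^ n := fun ψ hψ ↦ by
    obtain ⟨c, rfl⟩ := MonoidHom.mem_range.mp hψ
    exact ⟨(Multiplicative.toAdd c).val, rfl⟩
  -- local behaviour of the powers of `χ`
  have htriv : ∀ v : HeightOneSpectrum (𝓞 ℚ), ((ℓ : ℕ) : 𝓞 ℚ) ∉ v.asIdeal →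
      (∀ u : (ZMod ℓ)ˣ, (u : ZMod ℓ) = (v.residueCard : ZMod ℓ) → π₀ u = 1) →
      ∀ ψ ∈ V, ∀ σ : absoluteGaloisGroup (v.adicCompletion ℚ),
        ψ (resGal (K := ℚ) (v.adicCompletion ℚ) σ) = 1 := by
    intro v hℓv hπ ψ hψ σ
    obtain ⟨n, rfl⟩ := hVmem ψ hψ
    rw [ContinuousMonoidHom.pow_apply, character_eq_one_of_residueCard π₀ red hred χ hχ hℓv hπ σ, one_pow]
  have hunr : ∀ v : HeightOneSpectrum (𝓞 ℚ), ((ℓ : ℕ) : 𝓞 ℚ) ∉ v.asIdeal →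
      ∀ ψ ∈ V, ∀ τ ∈ absInertia (v.adicCompletion ℚ), ψ (resGal (K := ℚ) (v.adicCompletion ℚ) τ) = 1 := by
    intro v hℓv ψ hψ τ hτ
    obtain ⟨n, rfl⟩ := hVmem ψ hψ
    rw [ContinuousMonoidHom.pow_apply, character_eq_one_of_mem_absInertia π₀ red χ hχ hℓv hτ, one_pow]
  have hℓ_of : ∀ v : HeightOneSpectrum (𝓞 ℚ), (v ∈ S ∨ ((p : ℕ) : 𝓞 ℚ) ∈ v.asIdeal) →
      ((ℓ : ℕ) : 𝓞 ℚ) ∉ v.asIdeal := by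
    rintro v hv hℓv
    have hveq : v = vℓ := ((natCast_mem_asIdeal_iff_eq_primesEquiv_symm v hℓ.out).mp hℓv).trans
      ((natCast_mem_asIdeal_iff_eq_primesEquiv_symm vℓ hℓ.out).mp hvℓ).symm
    subst hveq
    rcases hv with hv | hv
    · exact hℓS hv
    · exact hℓp hv
  refine X2.algebraicLambdaGE_of_kummerCharacters_stacked_of_dvd_torsionOrder hodd hPT h415 hWu hpar hmult
    htors S hSp hcv V (fun ψ hψ v hv σ ↦ htriv v (hℓ_of v hv) (hres v hv) ψ hψ σ) (fun ψ hψ v hvS hvp ↦ ?_)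
    hμ (by rw [hVcard]; exact hb)
  by_cases hvℓ' : ((ℓ : ℕ) : 𝓞 ℚ) ∈ v.asIdeal
  · -- `v = v_ℓ`: the Kummer place
    have hveq : v = vℓ := ((natCast_mem_asIdeal_iff_eq_primesEquiv_symm v hℓ.out).mp hvℓ').trans
      ((natCast_mem_asIdeal_iff_eq_primesEquiv_symm vℓ hℓ.out).mp hvℓ).symm
    subst hveq
    exact Or.inr (Or.inr hKum)
  · by_cases hgood : W.HasGoodReductionAt v
    · exact Or.inl ⟨hgood, hunr v hvℓ' ψ hψ⟩
    · rcases hbad v hvS hvp hvℓ' hgood with hπ | hK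
      · exact Or.inr (Or.inl (htriv v hvℓ' hπ ψ hψ))
      · exact Or.inr (Or.inr hK)


end Summit.BirchSwinnertonDyer.BirchSwinnertonDyer.Theorems.EisensteinPrimesMazurMCOnCellBKummerPrimeCertificate

end
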